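import Mathlib
import Summits.NavierStokesRegularity.NavierStokesRegularity.Theses.LandauTail
import Summits.NavierStokesRegularity.NavierStokesRegularity.Theorems.LandauTailLandauTailBlowupTightCut
import Literature.Analysis.FluidPDE.AncientSimilarityVariables
import Literature.Analysis.FluidPDE.HomogeneousEuler

/-!
# NavierStokesRegularity — route `LandauTail`, crux `LandauTailBlowup`: the crux in Leray's
  backward similarity variables

Helper file for the crux item `stmt-NavierStokesRegularity-1944` (`LandauTail.LandauTailBlowup`, line
`registered` = `Cruxes/LandauTailBlowup/Lines/birth.lean`, cut `X ⇐ LandauTailLocal ∧ LandauTailTransfer`,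
proved tight in `LandauTailLandauTailBlowupTightCut`). It rewrites the SINGULARITY MODEL
`LandauTailLocal` (item stmt-NavierStokesRegularity-1946, the line's hardest stub) — and hence, by the
tight cut, the crux — in Leray's backward similarity variables
`V(s, y) = √(−t) u(t, √(−t) y)`, `s = −log(−t)` (`Literature.Analysis.FluidPDE.lerayOrbit`,
`IsBackwardLeraySolutionOn`; Leray 1934 (3.11)–(3.12), Chae–Wolf 2017 §4):

* `landauTail_tail_iff_tendsto_lerayOrbit` — the parabolic Landau-tail clause
  `√(0 − t) • u t (√(0 − t) • y) → L` (`t → 0⁻`) is literally `lerayOrbit u s y → L` (`s → +∞`):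
  the tail function composed with `τ(s) = −e^{−s}` IS the orbit;
* `landauTail_isClassicalNSSolutionOn_Ioo_iff` — classical unforced NS on `(−1, 0) × ℝ³` ⇔ the orbit
  solves the backward Leray system on `(0, ∞) × ℝ³` (the dictionary with `τ⁻¹((−1,0)) = (0,∞)`);
* `landauTail_ball_energy_lerayOrbit`, `landauTail_ball_dissipation_lerayOrbit`,
  `landauTail_setLIntegral_Ioo_eq_Ioi` — the Tsai local-energy clauses transported:
  `∫_{B_{e^{s/2}}} |V(s)|² = e^{s/2} ∫_{B₁} |u(t)|²` and `∫_{B_{e^{s/2}}} |∇V(s)|² = e^{−s/2} ∫_{B₁} |∇u(t)|²`,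
  `dt = e^{−s} ds`: the unit-scale local energy bound allows the similarity-variable energy on the
  expanding balls `B_{e^{s/2}}` to grow like `e^{s/2}` (no scale-invariant control);
* `landauTail_profile_leray_punctured` — a steady `(−1)`-homogeneous profile smooth off the origin is a
  PUNCTURED STEADY STATE of the backward Leray system: Euler's relation `DU(y)y = −U(y)` cancels the
  Leray drift `½U + ½(y·∇)U` off the origin;
* `landauTailLocal_iff_backwardLeray` — `LandauTailLocal` ⇔ there is a classical solution `(V, Q)` of
  the backward Leray system (ν = 1) on `(0, ∞) × ℝ³`, with the transported energy bounds, converging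
  POINTWISE off the origin, as `s → +∞`, to a nonzero steady `(−1)`-homogeneous profile `U` smooth off
  `0` — i.e. a forward-global orbit of Leray's system converging pointwise to the singular punctured
  equilibrium `U`;
* `landauTailBlowup_iff_backwardLeray_and_transfer` — the same for the crux via the tight cut (a
  witness of the crux is, in particular, such an orbit: `(… .1 h).1`).

References: J. Leray, Acta Math. 63 (1934), (3.11)–(3.12); D. Chae, J. Wolf, ARMA 225 (2017), §4
(similarity transform); T.-P. Tsai, ARMA 143 (1998), Thm 2 (local energy class); V. Šverák,
arXiv:math/0604550 (Landau solutions = the homogeneous steady states).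
-/

noncomputable section

open Filter Set Topology MeasureTheory Metric
open scoped ENNReal NNReal
open Literature.Analysis.FluidPDE

-- the summit-side namespace repeats a component by design (D-0017)
set_option linter.dupNamespace false

namespace Summit.NavierStokesRegularity.NavierStokesRegularity.Theorems

/-! ### The time maps `τ(s) = −e^{−s}` and `σ(t) = −log(−t)` at the blow-up time -/

/-- `τ(s) = −e^{−s} → 0⁻` as `s → +∞`. [folklore] -/
theorem landauTail_tendsto_ancientSimTime_atTop :
    Tendsto ancientSimTime atTop (𝓝[<] (0 : ℝ)) := by
  refine tendsto_nhdsWithin_iff.2 ⟨?_, Eventually.of_forall fun s => ancientSimTime_neg s⟩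
  have h := Real.tendsto_exp_neg_atTop_nhds_zero.neg
  rw [neg_zero] at h
  exact h

/-- `σ(t) = −log(−t) → +∞` as `t → 0⁻`. [folklore] -/
theorem landauTail_tendsto_ancientSimTimeInv :
    Tendsto ancientSimTimeInv (𝓝[<] (0 : ℝ)) atTop := by
  have h1 : Tendsto (fun t : ℝ => Real.log (-t)) (𝓝[<] 0) atBot := by
    have : (fun t : ℝ => Real.log (-t)) = Real.log := funext fun t => Real.log_neg_eq_log t
    rw [this]
    exact Real.tendsto_log_nhdsLT_zero
  exact tendsto_neg_atBot_atTop.comp h1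

/-- `τ⁻¹((−1, 0)) = (0, ∞)`: the last unit of physical time is the forward similarity half-line. [folklore] -/
theorem landauTail_preimage_ancientSimTime_Ioo :
    ancientSimTime ⁻¹' Ioo (-1 : ℝ) 0 = Ioi 0 := by
  ext s
  simp only [mem_preimage, mem_Ioo, mem_Ioi, ancientSimTime_apply]
  constructor
  · rintro ⟨h1, -⟩
    have h2 : Real.exp (-s) < 1 := by linarith
    have h3 := Real.exp_lt_one_iff.mp h2
    linarith
  · intro hs
    refine ⟨?_, neg_neg_of_pos (Real.exp_pos _)⟩
    have h2 : Real.exp (-s) < 1 := Real.exp_lt_one_iff.mpr (by linarith)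
    linarith

/-- `τ((0, ∞)) = (−1, 0)`. [folklore] -/
theorem landauTail_image_ancientSimTime_Ioi :
    ancientSimTime '' Ioi (0 : ℝ) = Ioo (-1) 0 := by
  rw [← landauTail_preimage_ancientSimTime_Ioo, image_preimage_ancientSimTime (fun t ht => ht.2)]

/-- `τ(s) ∈ (−1, 0)` for `s > 0`. [folklore] -/
theorem landauTail_ancientSimTime_mem_Ioo {s : ℝ} (hs : 0 < s) : ancientSimTime s ∈ Ioo (-1 : ℝ) 0 := by
  have : s ∈ ancientSimTime ⁻¹' Ioo (-1 : ℝ) 0 := by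
    rw [landauTail_preimage_ancientSimTime_Ioo]; exact hs
  exact this

/-- `σ(t) > 0` for `t ∈ (−1, 0)`. [folklore] -/
theorem landauTail_ancientSimTimeInv_pos {t : ℝ} (ht : t ∈ Ioo (-1 : ℝ) 0) : 0 < ancientSimTimeInv t := by
  have h : ancientSimTime (ancientSimTimeInv t) ∈ Ioo (-1 : ℝ) 0 := by
    rw [ancientSimTime_ancientSimTimeInv ht.2]; exact ht
  have h' : ancientSimTimeInv t ∈ ancientSimTime ⁻¹' Ioo (-1 : ℝ) 0 := h
  rw [landauTail_preimage_ancientSimTime_Ioo] at h'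
  exact h'

/-! ### The tail clause is pointwise convergence of the orbit -/

/-- The parabolic-tail function composed with `τ` is the similarity orbit:
`√(0 − τ(s)) • u (τ s) (√(0 − τ(s)) • y) = lerayOrbit u s y` (`√(e^{−s}) = e^{−s/2}`). [folklore] -/
theorem landauTail_tailFun_comp_ancientSimTime (u : ℝ → EuclideanSpace ℝ (Fin 3) → EuclideanSpace ℝ (Fin 3)) (y : EuclideanSpace ℝ (Fin 3)) (s : ℝ) :
    Real.sqrt (0 - ancientSimTime s) • u (ancientSimTime s) (Real.sqrt (0 - ancientSimTime s) • y) =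
      lerayOrbit u s y := by
  rw [ancientSimTime_apply, zero_sub, neg_neg, sqrt_exp_neg, lerayOrbit_apply]

/-- **The Landau-tail clause in similarity variables.** For any field `u`, point `y` and value `L`:
`√(0 − t) • u t (√(0 − t) • y) → L` as `t → 0⁻` iff `lerayOrbit u s y → L` as `s → +∞`
(compose with the homeomorphisms `τ : ℝ → (−∞, 0)`, `σ = τ⁻¹`). [folklore] -/
theorem landauTail_tail_iff_tendsto_lerayOrbit (u : ℝ → EuclideanSpace ℝ (Fin 3) → EuclideanSpace ℝ (Fin 3)) (y : EuclideanSpace ℝ (Fin 3)) (L : EuclideanSpace ℝ (Fin 3)) :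
    Tendsto (fun t : ℝ => Real.sqrt (0 - t) • u t (Real.sqrt (0 - t) • y)) (𝓝[<] 0) (𝓝 L) ↔
      Tendsto (fun s : ℝ => lerayOrbit u s y) atTop (𝓝 L) := by
  constructor
  · intro h
    refine (h.comp landauTail_tendsto_ancientSimTime_atTop).congr fun s => ?_
    simp only [Function.comp_apply]
    exact landauTail_tailFun_comp_ancientSimTime u y s
  · intro h
    refine (h.comp landauTail_tendsto_ancientSimTimeInv).congr' ?_
    filter_upwards [self_mem_nhdsWithin] with t ht
    simp only [Function.comp_apply]
    rw [← landauTail_tailFun_comp_ancientSimTime u y, ancientSimTime_ancientSimTimeInv ht]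

/-! ### The dynamics: classical NS on `(−1, 0)` ⇔ backward Leray on `(0, ∞)` -/

/-- **Dictionary on the last unit of time.** `(u, p)` is a classical unforced Navier–Stokes solution
(viscosity `ν`) on `(−1, 0) × ℝ³` iff its similarity orbit `(lerayOrbit u, lerayOrbitPressure p)` is a
classical solution of the backward Leray system `∂ₛV + ½V + ½(y·∇)V + (V·∇)V + ∇Q = νΔV`, `div V = 0`
on `(0, ∞) × ℝ³` (Chae–Wolf 2017, §4; the tree's dictionary with `τ⁻¹((−1, 0)) = (0, ∞)`). [folklore] -/
theorem landauTail_isClassicalNSSolutionOn_Ioo_iff {ν : ℝ} {u : ℝ → EuclideanSpace ℝ (Fin 3) → EuclideanSpace ℝ (Fin 3)} {p : ℝ → EuclideanSpace ℝ (Fin 3) → ℝ} :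
    IsClassicalNSSolutionOn (Ioo (-1 : ℝ) 0) ν 0 u p ↔
      IsBackwardLeraySolutionOn (Ioi (0 : ℝ)) ν (lerayOrbit u) (lerayOrbitPressure p) := by
  rw [isClassicalNSSolutionOn_iff_isBackwardLeraySolutionOn_lerayOrbit isOpen_Ioo (fun t ht => ht.2),
    landauTail_preimage_ancientSimTime_Ioo]

/-! ### The local energy clauses transported -/

/-- The dilation `y ↦ e^{−s/2} y` pulls the unit ball back to the ball of radius `e^{s/2}`. [folklore] -/
theorem landauTail_preimage_ball_dilate (s : ℝ) :
    (fun y : EuclideanSpace ℝ (Fin 3) => (0 : EuclideanSpace ℝ (Fin 3)) + Real.exp (-s / 2) • y) ⁻¹' ball (0 : EuclideanSpace ℝ (Fin 3)) 1 = ball (0 : EuclideanSpace ℝ (Fin 3)) (Real.exp (s / 2)) := by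
  have hpos : 0 < Real.exp (-s / 2) := Real.exp_pos _
  have key : Real.exp (-s / 2) * Real.exp (s / 2) = 1 := by
    rw [← Real.exp_add, show -s / 2 + s / 2 = 0 by ring, Real.exp_zero]
  ext y
  simp only [mem_preimage, zero_add, mem_ball, dist_zero_right, norm_smul, Real.norm_eq_abs,
    abs_of_pos hpos]
  constructor
  · intro h
    calc ‖y‖ = Real.exp (-s / 2) * ‖y‖ * Real.exp (s / 2) := by
          rw [mul_comm (Real.exp _) ‖y‖, mul_assoc, key, mul_one]
      _ < 1 * Real.exp (s / 2) := mul_lt_mul_of_pos_right h (Real.exp_pos _)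
      _ = Real.exp (s / 2) := one_mul _
  · intro h
    calc Real.exp (-s / 2) * ‖y‖ < Real.exp (-s / 2) * Real.exp (s / 2) := mul_lt_mul_of_pos_left h hpos
      _ = 1 := key

/-- `(e^{−s/2})² · ((e^{−s/2})³)⁻¹ = e^{s/2}`. [folklore] -/
theorem landauTail_exp_weights_energy (s : ℝ) :
    Real.exp (-s / 2) ^ 2 * (Real.exp (-s / 2) ^ 3)⁻¹ = Real.exp (s / 2) := by
  have hpos : 0 < Real.exp (-s / 2) := Real.exp_pos _
  have h1 : Real.exp (-s / 2) ^ 2 * (Real.exp (-s / 2) ^ 3)⁻¹ = (Real.exp (-s / 2))⁻¹ := by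
    field_simp
  rw [h1, ← Real.exp_neg]
  congr 1
  ring

/-- `(e^{−s})² · ((e^{−s/2})³)⁻¹ = e^{−s/2}`. [folklore] -/
theorem landauTail_exp_weights_dissipation (s : ℝ) :
    Real.exp (-s) ^ 2 * (Real.exp (-s / 2) ^ 3)⁻¹ = Real.exp (-s / 2) := by
  have hpos : 0 < Real.exp (-s / 2) := Real.exp_pos _
  have hsq : Real.exp (-s) = Real.exp (-s / 2) ^ 2 := (exp_neg_half_sq s).symm
  rw [hsq]
  field_simp

/-- **Local kinetic energy in similarity variables.** For every field `u` and similarity time `s`,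
`∫_{B_{e^{s/2}}} ‖lerayOrbit u s‖² = e^{s/2} ∫_{B₁} ‖u(−e^{−s})‖²`: the unit ball at time
`t = −e^{−s}` is the ball of radius `e^{s/2} = 1/√(−t)` in `y = x/√(−t)`, `|V|² = (−t)|u|²`,
`dy = (−t)^{−3/2} dx`. Consequently Tsai's bound `sup_t ∫_{B₁}|u(t)|² ≤ C` lets the
similarity-variable energy on the expanding balls grow like `e^{s/2}`. [folklore] -/
theorem landauTail_ball_energy_lerayOrbit (u : ℝ → EuclideanSpace ℝ (Fin 3) → EuclideanSpace ℝ (Fin 3)) (s : ℝ) :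
    ∫⁻ y in ball (0 : EuclideanSpace ℝ (Fin 3)) (Real.exp (s / 2)), ‖lerayOrbit u s y‖ₑ ^ 2 =
      ENNReal.ofReal (Real.exp (s / 2)) * ∫⁻ x in ball (0 : EuclideanSpace ℝ (Fin 3)) 1, ‖u (-Real.exp (-s)) x‖ₑ ^ 2 := by
  have hγ : 0 < Real.exp (-s / 2) := Real.exp_pos _
  have h := setLIntegral_preimage_comp_space_affine hγ (0 : EuclideanSpace ℝ (Fin 3))
    (fun x => ‖u (-Real.exp (-s)) x‖ₑ ^ 2) (ball 0 1)
  rw [landauTail_preimage_ball_dilate] at h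
  have hc : ‖Real.exp (-s / 2)‖ₑ ^ 2 ≠ ∞ := ENNReal.pow_ne_top enorm_ne_top
  calc ∫⁻ y in ball (0 : EuclideanSpace ℝ (Fin 3)) (Real.exp (s / 2)), ‖lerayOrbit u s y‖ₑ ^ 2
      = ∫⁻ y in ball (0 : EuclideanSpace ℝ (Fin 3)) (Real.exp (s / 2)),
          ‖Real.exp (-s / 2)‖ₑ ^ 2 * ‖u (-Real.exp (-s)) ((0 : EuclideanSpace ℝ (Fin 3)) + Real.exp (-s / 2) • y)‖ₑ ^ 2 := by
        refine lintegral_congr fun y => ?_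
        rw [lerayOrbit_apply, enorm_smul, mul_pow, zero_add]
    _ = ‖Real.exp (-s / 2)‖ₑ ^ 2 * (ENNReal.ofReal (Real.exp (-s / 2) ^ Module.finrank ℝ (EuclideanSpace ℝ (Fin 3)))⁻¹ *
          ∫⁻ x in ball (0 : EuclideanSpace ℝ (Fin 3)) 1, ‖u (-Real.exp (-s)) x‖ₑ ^ 2) := by
        rw [lintegral_const_mul' _ _ hc, h]
    _ = ENNReal.ofReal (Real.exp (s / 2)) * ∫⁻ x in ball (0 : EuclideanSpace ℝ (Fin 3)) 1, ‖u (-Real.exp (-s)) x‖ₑ ^ 2 := by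
        rw [← mul_assoc]
        congr 1
        rw [finrank_euclideanSpace_fin, Real.enorm_eq_ofReal hγ.le, ← ENNReal.ofReal_pow hγ.le,
          ← ENNReal.ofReal_mul (by positivity), landauTail_exp_weights_energy]

/-- **Local dissipation in similarity variables.** For every field `u` and similarity time `s`,
`∫_{B_{e^{s/2}}} |∇ lerayOrbit u s|²_F = e^{−s/2} ∫_{B₁} |∇u(−e^{−s})|²_F` (`∇_y V = (−t) ∇ₓ u`,
`dy = (−t)^{−3/2} dx`; no differentiability needed). [folklore] -/
theorem landauTail_ball_dissipation_lerayOrbit (u : ℝ → EuclideanSpace ℝ (Fin 3) → EuclideanSpace ℝ (Fin 3)) (s : ℝ) :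
    ∫⁻ y in ball (0 : EuclideanSpace ℝ (Fin 3)) (Real.exp (s / 2)), ENNReal.ofReal (frobeniusNormSq (fderiv ℝ (lerayOrbit u s) y)) =
      ENNReal.ofReal (Real.exp (-s / 2)) *
        ∫⁻ x in ball (0 : EuclideanSpace ℝ (Fin 3)) 1, ENNReal.ofReal (frobeniusNormSq (fderiv ℝ (u (-Real.exp (-s))) x)) := by
  have hγ : 0 < Real.exp (-s / 2) := Real.exp_pos _
  have h := setLIntegral_preimage_comp_space_affine hγ (0 : EuclideanSpace ℝ (Fin 3))
    (fun x => ENNReal.ofReal (frobeniusNormSq (fderiv ℝ (u (-Real.exp (-s))) x))) (ball 0 1)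
  rw [landauTail_preimage_ball_dilate] at h
  calc ∫⁻ y in ball (0 : EuclideanSpace ℝ (Fin 3)) (Real.exp (s / 2)), ENNReal.ofReal (frobeniusNormSq (fderiv ℝ (lerayOrbit u s) y))
      = ∫⁻ y in ball (0 : EuclideanSpace ℝ (Fin 3)) (Real.exp (s / 2)), ENNReal.ofReal (Real.exp (-s) ^ 2) *
          ENNReal.ofReal (frobeniusNormSq (fderiv ℝ (u (-Real.exp (-s))) ((0 : EuclideanSpace ℝ (Fin 3)) + Real.exp (-s / 2) • y))) := by
        refine lintegral_congr fun y => ?_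
        rw [fderiv_lerayOrbit, frobeniusNormSq_smul, ENNReal.ofReal_mul (sq_nonneg _), zero_add]
    _ = ENNReal.ofReal (Real.exp (-s) ^ 2) * (ENNReal.ofReal (Real.exp (-s / 2) ^ Module.finrank ℝ (EuclideanSpace ℝ (Fin 3)))⁻¹ *
          ∫⁻ x in ball (0 : EuclideanSpace ℝ (Fin 3)) 1, ENNReal.ofReal (frobeniusNormSq (fderiv ℝ (u (-Real.exp (-s))) x))) := by
        rw [lintegral_const_mul' _ _ ENNReal.ofReal_ne_top, h]
    _ = ENNReal.ofReal (Real.exp (-s / 2)) *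
          ∫⁻ x in ball (0 : EuclideanSpace ℝ (Fin 3)) 1, ENNReal.ofReal (frobeniusNormSq (fderiv ℝ (u (-Real.exp (-s))) x)) := by
        rw [← mul_assoc]
        congr 1
        rw [finrank_euclideanSpace_fin, ← ENNReal.ofReal_mul (sq_nonneg _), landauTail_exp_weights_dissipation]

/-- **Time change of variables at the blow-up time** (lower integrals): `∫_{(−1,0)} G(t) dt =
∫_{(0,∞)} e^{−s} G(τ s) ds`, `t = τ(s) = −e^{−s}` (one-dimensional change of variables for the
injective differentiable map `τ`, `|τ'(s)| = e^{−s}`). [folklore] -/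
theorem landauTail_setLIntegral_Ioo_eq_Ioi (G : ℝ → ℝ≥0∞) :
    ∫⁻ t in Ioo (-1 : ℝ) 0, G t = ∫⁻ s in Ioi (0 : ℝ), ENNReal.ofReal (Real.exp (-s)) * G (ancientSimTime s) := by
  rw [← landauTail_image_ancientSimTime_Ioi,
    lintegral_image_eq_lintegral_abs_deriv_mul measurableSet_Ioi
      (fun s _ => (hasDerivAt_ancientSimTime s).hasDerivWithinAt) ancientSimTime_injective.injOn]
  refine setLIntegral_congr_fun measurableSet_Ioi fun s _ => ?_
  rw [abs_of_pos (Real.exp_pos _)]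

/-! ### The profile is a punctured steady state of the backward Leray system -/

/-- **Landau-class profiles are punctured equilibria of Leray's system.** If `U` is smooth off the
origin, solves the steady system `(U·∇)U + ∇P = νΔU` off the origin and is homogeneous of degree `−1`,
then off the origin it satisfies the steady backward Leray profile equation
`½U + ½(y·∇)U + (U·∇)U + ∇P = νΔU`: Euler's relation `DU(y)y = −U(y)` for degree `−1` fields
(`fderiv_apply_self_of_smul_eq_rpow_smul`) kills the Leray drift. So the limit object of the tail is a
steady solution of the very system the orbit solves, singular exactly at the puncture `y = 0`
(Leray 1934, (3.11); the scaling term vanishes on `(−1)`-homogeneous fields). [folklore] -/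
theorem landauTail_profile_leray_punctured {ν : ℝ} {U : EuclideanSpace ℝ (Fin 3) → EuclideanSpace ℝ (Fin 3)} {P : EuclideanSpace ℝ (Fin 3) → ℝ}
    (hU : ContDiffOn ℝ (⊤ : ℕ∞) U {0}ᶜ)
    (hNS : ∀ x : EuclideanSpace ℝ (Fin 3), x ≠ 0 → convect U U x + gradient P x = ν • Laplacian.laplacian U x)
    (hhom : ∀ c : ℝ, 0 < c → ∀ x : EuclideanSpace ℝ (Fin 3), U (c • x) = c⁻¹ • U x) :
    ∀ y : EuclideanSpace ℝ (Fin 3), y ≠ 0 → (1 / 2 : ℝ) • U y + (1 / 2 : ℝ) • fderiv ℝ U y y + convect U U y + gradient P y =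
      ν • Laplacian.laplacian U y := by
  intro y hy
  have hdiff : DifferentiableAt ℝ U y :=
    (hU.differentiableOn (by simp)).differentiableAt (isOpen_compl_singleton.mem_nhds hy)
  have hEul : fderiv ℝ U y y = (-1 : ℝ) • U y := by
    refine fderiv_apply_self_of_smul_eq_rpow_smul (m := -1) (fun c hc => ?_) hdiff
    rw [Real.rpow_neg_one]
    exact hhom c hc y
  have hzero : (1 / 2 : ℝ) • U y + (1 / 2 : ℝ) • ((-1 : ℝ) • U y) = 0 := by
    rw [smul_smul, ← add_smul]
    norm_num
  rw [hEul, hzero, zero_add]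
  exact hNS y hy

/-! ### `LandauTailLocal` in similarity variables -/

/-- **The singularity model in Leray's variables** (item stmt-NavierStokesRegularity-1946 restated,
kernel-checked equivalence). `LandauTailLocal` holds iff there are a classical solution `(V, Q)` of the
backward Leray system with `ν = 1` on the forward half-line `(0, ∞) × ℝ³` and a nonzero steady
`(−1)`-homogeneous profile `(U, P)` smooth off the origin (steady NS off `0`; a Landau solution by
Šverák 2011; a punctured equilibrium of the same system by `landauTail_profile_leray_punctured`) with
(i) the transported Tsai bounds `∫_{B_{e^{s/2}}} |V(s)|² ≤ C e^{s/2}` (`s > 0`) and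
`∫₀^∞ e^{−s/2} ∫_{B_{e^{s/2}}} |∇V(s)|²_F ds < ∞`, and (ii) POINTWISE convergence off the puncture,
`V(s, y) → U(y)` as `s → +∞` for every `y ≠ 0`. Directions: `→` reads the witness through
`V = lerayOrbit u`; `←` through `u = ofLerayOrbit V` (`lerayOrbit ∘ ofLerayOrbit = id`). [folklore] -/
theorem landauTailLocal_iff_backwardLeray :
    Summit.NavierStokesRegularity.NavierStokesRegularity.Theses.LandauTail.LandauTailLocal ↔ ∃ (V : ℝ →
    EuclideanSpace ℝ (Fin 3) → EuclideanSpace ℝ (Fin 3)) (Q : ℝ → EuclideanSpace ℝ (Fin 3) → ℝ) (U :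
    EuclideanSpace ℝ (Fin 3) → EuclideanSpace ℝ (Fin 3)) (P : EuclideanSpace ℝ (Fin 3) → ℝ), (ContDiffOn ℝ
    (⊤ : ℕ∞) U {0}ᶜ ∧ ContDiffOn ℝ (⊤ : ℕ∞) P {0}ᶜ ∧ (∀ x : EuclideanSpace ℝ (Fin 3), x ≠ 0 →
    Literature.Analysis.FluidPDE.convect U U x + gradient P x = (1 : ℝ) • Laplacian.laplacian U x) ∧ (∀ x :
    EuclideanSpace ℝ (Fin 3), x ≠ 0 → Literature.Analysis.FluidPDE.VectorCalculus.divergence U x = 0) ∧ (∀ c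
    : ℝ, 0 < c → ∀ x : EuclideanSpace ℝ (Fin 3), U (c • x) = c⁻¹ • U x) ∧ (∃ x : EuclideanSpace ℝ (Fin 3), U
    x ≠ 0)) ∧ Literature.Analysis.FluidPDE.IsBackwardLeraySolutionOn (Set.Ioi (0 : ℝ)) 1 V Q ∧ (∃ C :
    NNReal, ∀ s ∈ Set.Ioi (0 : ℝ), ∫⁻ y in Metric.ball (0 : EuclideanSpace ℝ (Fin 3)) (Real.exp (s / 2)), ‖V
    s y‖ₑ ^ 2 ≤ C * ENNReal.ofReal (Real.exp (s / 2))) ∧ (∫⁻ s in Set.Ioi (0 : ℝ), ENNReal.ofReal (Real.exp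
    (-s / 2)) * ∫⁻ y in Metric.ball (0 : EuclideanSpace ℝ (Fin 3)) (Real.exp (s / 2)), ENNReal.ofReal
    (Literature.Analysis.FluidPDE.frobeniusNormSq (fderiv ℝ (V s) y)) < ⊤) ∧ (∀ y : EuclideanSpace ℝ (Fin
    3), y ≠ 0 → Filter.Tendsto (fun s : ℝ => V s y) Filter.atTop (nhds (U y))) := by
  unfold Summit.NavierStokesRegularity.NavierStokesRegularity.Theses.LandauTail.LandauTailLocal
  -- pointwise identity of the weighted dissipation integrands (used in both directions)
  have hdiss : ∀ (u : ℝ → EuclideanSpace ℝ (Fin 3) → EuclideanSpace ℝ (Fin 3)) (s : ℝ),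
      ENNReal.ofReal (Real.exp (-s / 2)) *
          ∫⁻ y in ball (0 : EuclideanSpace ℝ (Fin 3)) (Real.exp (s / 2)), ENNReal.ofReal (frobeniusNormSq (fderiv ℝ (lerayOrbit u s) y)) =
        ENNReal.ofReal (Real.exp (-s)) *
          ∫⁻ x in ball (0 : EuclideanSpace ℝ (Fin 3)) 1, ENNReal.ofReal (frobeniusNormSq (fderiv ℝ (u (ancientSimTime s)) x)) := by
    intro u s
    rw [landauTail_ball_dissipation_lerayOrbit, ← mul_assoc, ← ENNReal.ofReal_mul (Real.exp_pos _).le,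
      exp_neg_half_mul_self, ancientSimTime_apply]
  constructor
  · rintro ⟨u, p, U, P, hprof, hcl, ⟨C, hC⟩, hD, htail⟩
    refine ⟨lerayOrbit u, lerayOrbitPressure p, U, P, hprof,
      landauTail_isClassicalNSSolutionOn_Ioo_iff.1 hcl, ⟨C, fun s hs => ?_⟩, ?_, fun y hy => ?_⟩
    · -- energy on the expanding balls
      rw [landauTail_ball_energy_lerayOrbit, mul_comm]
      have ht : -Real.exp (-s) ∈ Ioo (-1 : ℝ) 0 := landauTail_ancientSimTime_mem_Ioo hs
      exact mul_le_mul_left (hC _ ht) _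
    · -- dissipation
      calc ∫⁻ s in Ioi (0 : ℝ), ENNReal.ofReal (Real.exp (-s / 2)) *
            ∫⁻ y in ball (0 : EuclideanSpace ℝ (Fin 3)) (Real.exp (s / 2)), ENNReal.ofReal (frobeniusNormSq (fderiv ℝ (lerayOrbit u s) y))
          = ∫⁻ s in Ioi (0 : ℝ), ENNReal.ofReal (Real.exp (-s)) *
            ∫⁻ x in ball (0 : EuclideanSpace ℝ (Fin 3)) 1, ENNReal.ofReal (frobeniusNormSq (fderiv ℝ (u (ancientSimTime s)) x)) :=
            lintegral_congr fun s => hdiss u s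
        _ = ∫⁻ t in Ioo (-1 : ℝ) 0, ∫⁻ x in ball (0 : EuclideanSpace ℝ (Fin 3)) 1, ENNReal.ofReal (frobeniusNormSq (fderiv ℝ (u t) x)) :=
            (landauTail_setLIntegral_Ioo_eq_Ioi (fun t =>
              ∫⁻ x in ball (0 : EuclideanSpace ℝ (Fin 3)) 1, ENNReal.ofReal (frobeniusNormSq (fderiv ℝ (u t) x)))).symm
        _ < ⊤ := hD
    · exact (landauTail_tail_iff_tendsto_lerayOrbit u y (U y)).1 (htail y hy)
  · rintro ⟨V, Q, U, P, hprof, hL, ⟨C, hC⟩, hD, htail⟩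
    set u : ℝ → EuclideanSpace ℝ (Fin 3) → EuclideanSpace ℝ (Fin 3) := ofLerayOrbit V with hu
    set p : ℝ → EuclideanSpace ℝ (Fin 3) → ℝ := ofLerayOrbitPressure Q with hp
    have hV : lerayOrbit u = V := lerayOrbit_ofLerayOrbit_eq V
    have hQ : lerayOrbitPressure p = Q := lerayOrbitPressure_ofLerayOrbitPressure_eq Q
    refine ⟨u, p, U, P, hprof, ?_, ⟨C, fun t ht => ?_⟩, ?_, fun y hy => ?_⟩
    · -- dynamics
      rw [landauTail_isClassicalNSSolutionOn_Ioo_iff, hV, hQ]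
      exact hL
    · -- energy at a physical time t ∈ (−1, 0), read at s = σ(t)
      set s : ℝ := ancientSimTimeInv t with hs_def
      have hs : 0 < s := landauTail_ancientSimTimeInv_pos ht
      have hts : -Real.exp (-s) = t := ancientSimTime_ancientSimTimeInv ht.2
      have key := landauTail_ball_energy_lerayOrbit u s
      rw [hV, hts] at key
      have hbound : ENNReal.ofReal (Real.exp (s / 2)) * ∫⁻ x in ball (0 : EuclideanSpace ℝ (Fin 3)) 1, ‖u t x‖ₑ ^ 2 ≤
          ENNReal.ofReal (Real.exp (s / 2)) * C := by
        rw [← key, mul_comm _ (C : ℝ≥0∞)]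
        exact hC s hs
      exact (ENNReal.mul_le_mul_iff_right (ENNReal.ofReal_pos.2 (Real.exp_pos _)).ne' ENNReal.ofReal_ne_top).1 hbound
    · -- dissipation
      calc ∫⁻ t in Ioo (-1 : ℝ) 0, ∫⁻ x in ball (0 : EuclideanSpace ℝ (Fin 3)) 1, ENNReal.ofReal (frobeniusNormSq (fderiv ℝ (u t) x))
          = ∫⁻ s in Ioi (0 : ℝ), ENNReal.ofReal (Real.exp (-s)) *
            ∫⁻ x in ball (0 : EuclideanSpace ℝ (Fin 3)) 1, ENNReal.ofReal (frobeniusNormSq (fderiv ℝ (u (ancientSimTime s)) x)) :=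
            landauTail_setLIntegral_Ioo_eq_Ioi (fun t =>
              ∫⁻ x in ball (0 : EuclideanSpace ℝ (Fin 3)) 1, ENNReal.ofReal (frobeniusNormSq (fderiv ℝ (u t) x)))
        _ = ∫⁻ s in Ioi (0 : ℝ), ENNReal.ofReal (Real.exp (-s / 2)) *
            ∫⁻ y in ball (0 : EuclideanSpace ℝ (Fin 3)) (Real.exp (s / 2)), ENNReal.ofReal (frobeniusNormSq (fderiv ℝ (V s) y)) := by
            refine lintegral_congr fun s => ?_
            rw [← hdiss u s, hV]
        _ < ⊤ := hD
    · refine (landauTail_tail_iff_tendsto_lerayOrbit u y (U y)).2 ?_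
      rw [hV]
      exact htail y hy

/-! ### The crux in similarity variables -/

/-- **The crux in Leray's variables.** `LandauTailBlowup` holds iff (a) there is a forward-global
classical orbit of the backward Leray system (ν = 1) on `(0, ∞) × ℝ³` with the transported Tsai
bounds converging pointwise off the origin to a nonzero steady `(−1)`-homogeneous profile smooth off
`0`, and (b) the localisation `LandauTailTransfer` (item stmt-NavierStokesRegularity-1948) holds —
the tight cut `landauTailBlowup_iff_local_and_transfer` read through
`landauTailLocal_iff_backwardLeray`. [folklore] -/
theorem landauTailBlowup_iff_backwardLeray_and_transfer :
    Summit.NavierStokesRegularity.NavierStokesRegularity.Theses.LandauTail.LandauTailBlowup ↔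
      (∃ (V : ℝ → EuclideanSpace ℝ (Fin 3) → EuclideanSpace ℝ (Fin 3)) (Q : ℝ → EuclideanSpace ℝ (Fin 3) → ℝ) (U : EuclideanSpace ℝ (Fin 3) → EuclideanSpace ℝ (Fin 3)) (P : EuclideanSpace ℝ (Fin 3) → ℝ),
        (ContDiffOn ℝ (⊤ : ℕ∞) U {0}ᶜ ∧ ContDiffOn ℝ (⊤ : ℕ∞) P {0}ᶜ ∧
          (∀ x : EuclideanSpace ℝ (Fin 3), x ≠ 0 → convect U U x + gradient P x = (1 : ℝ) • Laplacian.laplacian U x) ∧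
          (∀ x : EuclideanSpace ℝ (Fin 3), x ≠ 0 → VectorCalculus.divergence U x = 0) ∧
          (∀ c : ℝ, 0 < c → ∀ x : EuclideanSpace ℝ (Fin 3), U (c • x) = c⁻¹ • U x) ∧ (∃ x : EuclideanSpace ℝ (Fin 3), U x ≠ 0)) ∧
        IsBackwardLeraySolutionOn (Ioi (0 : ℝ)) 1 V Q ∧
        (∃ C : ℝ≥0, ∀ s ∈ Ioi (0 : ℝ), ∫⁻ y in ball (0 : EuclideanSpace ℝ (Fin 3)) (Real.exp (s / 2)), ‖V s y‖ₑ ^ 2 ≤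
            C * ENNReal.ofReal (Real.exp (s / 2))) ∧
        (∫⁻ s in Ioi (0 : ℝ), ENNReal.ofReal (Real.exp (-s / 2)) *
            ∫⁻ y in ball (0 : EuclideanSpace ℝ (Fin 3)) (Real.exp (s / 2)), ENNReal.ofReal (frobeniusNormSq (fderiv ℝ (V s) y)) < ⊤) ∧
        (∀ y : EuclideanSpace ℝ (Fin 3), y ≠ 0 → Tendsto (fun s : ℝ => V s y) atTop (𝓝 (U y)))) ∧
      Summit.NavierStokesRegularity.NavierStokesRegularity.Theses.LandauTail.LandauTailTransfer := by
  rw [landauTailBlowup_iff_local_and_transfer, landauTailLocal_iff_backwardLeray]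

end Summit.NavierStokesRegularity.NavierStokesRegularity.Theorems

end
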